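import Literature.NumberTheory.PAdicHodge.UnramifiedWittPeriodMatrix
import Literature.NumberTheory.PAdicHodge.HodgeTateUnramifiedWeights
import Literature.NumberTheory.GaloisRepresentations.LabelledHodgeTateWeights
import Mathlib.LinearAlgebra.TensorProduct.Basis
import HarnessLib

/-!
# Unramified representations have Hodge–Tate weights `0` — for every period ring receiving `W(k̄)`

Continuation of `UnramifiedWittPeriodMatrix` (`PeriodRingData.isAdmissible_of_unramified_witt`:
unramified ⇒ `B`-admissible for every period-ring datum `𝔅` receiving a `Γ_F`-equivariant,
`ℤ_p`-compatible ring map `ι : W(k̄) → B`).  Here we compute the induced filtration on `D_B(V)`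
and the Hodge–Tate weights, under the two further hypotheses that hold for `B_dR(F)`
(`ι(W(k̄)) ⊆ 𝔸_inf ⊆ B_dR⁺ = Fil⁰`, and `Fil¹ = ker θ` with `θ ∘ ι = (W(k̄) ⊆ 𝒪̂_{F^nr} → ℂ_F)`,
file `UnramifiedWittBdR`):

* `(H0)` `ι(W(k̄)) ⊆ Fil⁰ B`;
* `(H1)` for every invertible `X ∈ M_N(W(k̄))` and `c ∈ F^N`: if `Σ_j c_j ι(X_{kj}) ∈ Fil¹ B` for
  all `k` then `c = 0` ("`Fil¹` detects `θ`": `θ(ι(X))` is invertible over `ℂ_F`).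

Main results (generic in `𝔅`; the `B_HT`-versions with `ι : 𝒪̂_{F^nr} → B_HT` are the accepted
`finrank_filD_of_unramified` / `hodgeTateWeights_of_unramified`, file `HodgeTateUnramifiedWeights`,
whose proof is followed verbatim):

* `PeriodRingData.finrank_filD_of_unramified_witt` — `dim_F Fil^i D_B(V) = dim V` for `i ≤ 0` and
  `= 0` for `i ≥ 1`, for unramified `V`;
* `PeriodRingData.hodgeTateWeights_of_unramified_witt` — **`hodgeTateWeights ρ = {0, …, 0}`**
  (`dim V` times): the generic form of clause (F3) `UnramifiedWeightsZero` of `IsFontaineDatum`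
  (Fontaine 1994, Exp. III §5: unramified ⇒ crystalline with `Fil⁰ D = D`, `Fil¹ D = 0`;
  Fontaine–Ouyang Prop. 2.14).

No definitions, no named facts.

## References
* [FontaineAsterisque223III] J.-M. Fontaine, Astérisque 223 (1994), Exp. III §1.5, §5.
* [FontaineOuyang2022] J.-M. Fontaine, Y. Ouyang, *Theory of p-adic Galois representations*, Prop. 2.14, Thm. 2.13.
-/

noncomputable section

open WittVector IsLocalRing Matrix Field ValuativeRel TensorProduct
open scoped ValuativeRel MatrixGroups TensorProduct

namespace Literature.NumberTheory.PAdicHodge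

open Literature.NumberTheory.GaloisRepresentations
open Literature.NumberTheory.GaloisRepresentations.IsNonarchimedeanLocalField

universe w₁ w₂

variable {F : Type} [Field F] [ValuativeRel F] [TopologicalSpace F] [IsNonarchimedeanLocalField F]
  {p : ℕ} [Fact p.Prime] [CharP (IsLocalRing.ResidueField (maxUnramifiedCompletion F)) p] [Algebra ℚ_[p] F]

/-! ### The Hodge filtration of `D_B(V)` for unramified `V` -/

open TensorProduct in
-- Mathlib's own global value of `maxSynthPendingDepth` (as in `PeriodRingData.isAdmissible_of_unramified`).
set_option maxSynthPendingDepth 3 in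
/-- **Hodge filtration of `D_B(V)` for unramified `V`, for every period ring `B` receiving `W(k̄)` in
`Fil⁰` with "`Fil¹` detects `θ`"**: let `𝔅` be a period-ring datum over `(ℚ_p, Γ_F)` with invariants
`F`, `ι : W(k̄) → B` a `Γ_F`-equivariant ring map compatible with `ℤ_p → ℚ_p → B`, with
`ι(W(k̄)) ⊆ Fil⁰ B`, and such that for every invertible `X ∈ M_N(W(k̄))` the vectors
`(ι(X_{kj}))_k` are `F`-linearly independent modulo `Fil¹ B` (for `B_dR`: `Fil¹ = ker θ` and
`θ(ι(X))` is invertible over `ℂ_F`).  Then for every unramified continuous `ρ` on a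
finite-dimensional `ℚ_p`-space `V`, `dim_F Fil^i D_B(V) = dim V` for `i ≤ 0` and `= 0` for `i ≥ 1`
(`D` has the `F`-basis `Σ_i ι(X_{ij}) ⊗ b_i`, `X` the period matrix over `W(k̄)`).
[cite: FontaineAsterisque223III, Exp. III §1.5 and §5] [cite: FontaineOuyang2022, Prop. 2.14] -/
theorem PeriodRingData.finrank_filD_of_unramified_witt
    (𝔅 : PeriodRingData.{0, 0, 0, w₁} (absoluteGaloisGroup F) ℚ_[p] F)
    (ι : WittVector p (IsLocalRing.ResidueField (maxUnramifiedCompletion F)) →+* 𝔅.B)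
    (hισ : ∀ (σ : absoluteGaloisGroup F) (x : WittVector p (IsLocalRing.ResidueField (maxUnramifiedCompletion F))),
      σ • ι x = ι (wittGal σ x))
    (hιp : ∀ z : ℤ_[p], ι (padicIntToWitt F p z) = algebraMap ℚ_[p] 𝔅.B (z : ℚ_[p]))
    (hι0 : ∀ x, ι x ∈ 𝔅.fil 0)
    (hι1 : ∀ {N : ℕ} {X : Matrix (Fin N) (Fin N) (WittVector p (IsLocalRing.ResidueField (maxUnramifiedCompletion F)))},
      IsUnit X → ∀ {c : Fin N → F}, (∀ k, (∑ j, c j • ι (X k j)) ∈ 𝔅.fil 1) → c = 0)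
    {V : Type w₂} [AddCommGroup V] [Module ℚ_[p] V] [TopologicalSpace V] [IsTopologicalAddGroup V]
    [ContinuousSMul ℚ_[p] V] [T2Space V] [FiniteDimensional ℚ_[p] V]
    (ρ : ContinuousRep (absoluteGaloisGroup F) ℚ_[p] V)
    (hρ : ∀ σ ∈ absInertia F, ∀ v : V, ρ σ v = v) (i : ℤ) :
    Module.finrank F (𝔅.filD ρ i) = if i ≤ 0 then Module.finrank ℚ_[p] V else 0 := by
  classical
  haveI : CompactSpace (absoluteGaloisGroup F) := absoluteGaloisGroup_compactSpace F
  set N := Module.finrank ℚ_[p] V with hN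
  -- an integral frame
  obtain ⟨b, r, hbr⟩ := ρ.exists_basis_integralFrame
  -- `r` is unramified
  have hr : ∀ σ ∈ absInertia F, r σ = 1 := by
    intro σ hσ
    refine Units.ext (Matrix.ext fun i j => PadicInt.ext ?_)
    have h1 := hbr σ j
    rw [hρ σ hσ] at h1
    have h2 := congrArg (fun v => b.repr v i) h1
    simp only [b.repr_sum_self, b.repr_self_apply] at h2
    rw [← h2, Units.val_one, Matrix.one_apply]
    by_cases hij : i = j
    · subst hij; simp
    · rw [if_neg (Ne.symm hij), if_neg hij, PadicInt.coe_zero]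
  -- the period matrix over `W(k̄)` and its image `Y` in `B`
  obtain ⟨X, hXu, hX⟩ := exists_isUnit_forall_eq_mul_wittGal (p := p) r hr
  set Y : Matrix (Fin N) (Fin N) 𝔅.B := ι.mapMatrix X with hYdef
  have hYapply : ∀ i j, Y i j = ι (X i j) := fun i j => rfl
  have hY : ∀ (σ : absoluteGaloisGroup F) (k j : Fin N),
      Y k j = ∑ i, (((r σ : GL (Fin N) ℤ_[p]) : Matrix (Fin N) (Fin N) ℤ_[p]) k i : ℚ_[p]) • σ • Y i j := by
    intro σ k j
    have h := congrArg (fun M : Matrix (Fin N) (Fin N) (WittVector p (IsLocalRing.ResidueField (maxUnramifiedCompletion F))) =>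
      ι (M k j)) (hX σ)
    simp only [Matrix.mul_apply, map_sum, map_mul] at h
    rw [hYapply, h]
    refine Finset.sum_congr rfl fun i _ => ?_
    rw [wittPeriodCoeff_apply, wittGalMatrix_apply, hιp, ← hισ, hYapply, Algebra.smul_def]
  -- the invariant vectors
  let w : Fin N → 𝔅.B ⊗[ℚ_[p]] V := fun j => ∑ i, Y i j ⊗ₜ[ℚ_[p]] b i
  have hwD : ∀ j, w j ∈ 𝔅.D ρ := by
    intro j
    rw [PeriodRingData.mem_D_iff]
    intro σ
    simp only [w, map_sum, PeriodRingData.tensorRep_apply_tmul]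
    calc ∑ i, (σ • Y i j) ⊗ₜ[ℚ_[p]] ρ σ (b i)
        = ∑ i, ∑ k, ((((r σ : GL (Fin N) ℤ_[p]) : Matrix (Fin N) (Fin N) ℤ_[p]) k i : ℚ_[p]) • σ • Y i j) ⊗ₜ[ℚ_[p]] b k := by
          refine Finset.sum_congr rfl fun i _ => ?_
          rw [hbr σ i, TensorProduct.tmul_sum]
          refine Finset.sum_congr rfl fun k _ => ?_
          exact (TensorProduct.smul_tmul _ _ _).symm
      _ = ∑ k, (∑ i, (((r σ : GL (Fin N) ℤ_[p]) : Matrix (Fin N) (Fin N) ℤ_[p]) k i : ℚ_[p]) • σ • Y i j) ⊗ₜ[ℚ_[p]] b k := by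
          rw [Finset.sum_comm]
          refine Finset.sum_congr rfl fun k _ => ?_
          rw [TensorProduct.sum_tmul]
      _ = ∑ k, Y k j ⊗ₜ[ℚ_[p]] b k := Finset.sum_congr rfl fun k _ => by rw [← hY σ k j]
  -- they are linearly independent over `B`, hence over `F`
  let β : Module.Basis (Fin N) 𝔅.B (𝔅.B ⊗[ℚ_[p]] V) := Algebra.TensorProduct.basis 𝔅.B b
  have hYdet : IsUnit Y.det := (Matrix.isUnit_iff_isUnit_det _).1 (hXu.map ι.mapMatrix)
  have hw : ∀ j, w j = Matrix.toLin β β Y (β j) := by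
    intro j
    rw [Matrix.toLin_self]
    refine Finset.sum_congr rfl fun i _ => ?_
    rw [Algebra.TensorProduct.basis_apply, TensorProduct.smul_tmul', smul_eq_mul, mul_one]
  have hliB : LinearIndependent 𝔅.B w := by
    have h := β.linearIndependent.map' (Matrix.toLin β β Y) (Matrix.ker_toLin_eq_bot β Y hYdet)
    rw [show w = ⇑(Matrix.toLin β β Y) ∘ ⇑β from funext hw]
    exact h
  have hliF : LinearIndependent F w := by
    refine hliB.restrict_scalars ?_
    intro x y hxy
    have h : algebraMap F 𝔅.B x = algebraMap F 𝔅.B y := by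
      simpa only [Algebra.smul_def, mul_one] using hxy
    exact (algebraMap F 𝔅.B).injective h
  have hliD : LinearIndependent F (fun j => (⟨w j, hwD j⟩ : 𝔅.D ρ)) :=
    LinearIndependent.of_comp (𝔅.D ρ).subtype (by exact hliF)
  -- `dim D = N` (admissibility), so the `w j` form a basis of `D`
  have hadm : Module.finrank F (𝔅.D ρ) = N := PeriodRingData.isAdmissible_of_unramified_witt 𝔅 ι hισ hιp ρ hρ
  haveI : FiniteDimensional F (𝔅.D ρ) :=
    Module.rank_lt_aleph0_iff.mp (lt_of_le_of_lt (𝔅.rank_D_le ρ) (Cardinal.natCast_lt_aleph0 (n := N)))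
  have hcard : Fintype.card (Fin N) = Module.finrank F (𝔅.D ρ) := by rw [Fintype.card_fin, hadm]
  let bD : Module.Basis (Fin N) F (𝔅.D ρ) := basisOfLinearIndependentOfCardEqFinrank' _ hliD hcard
  have hbD : ∀ j, ((bD j : 𝔅.D ρ) : 𝔅.B ⊗[ℚ_[p]] V) = w j := fun j => by
    rw [show bD j = (⟨w j, hwD j⟩ : 𝔅.D ρ) from
      congrFun (coe_basisOfLinearIndependentOfCardEqFinrank' _ hliD hcard) j]
  -- coordinates of an element of `D`
  have hrepr : ∀ x : 𝔅.D ρ, (x : 𝔅.B ⊗[ℚ_[p]] V) = ∑ k, (∑ j, bD.repr x j • Y k j) ⊗ₜ[ℚ_[p]] b k := by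
    intro x
    have h1 : (x : 𝔅.B ⊗[ℚ_[p]] V) = ∑ j, bD.repr x j • w j := by
      conv_lhs => rw [← bD.sum_repr x]
      rw [Submodule.coe_sum]
      refine Finset.sum_congr rfl fun j _ => ?_
      rw [Submodule.coe_smul, hbD]
    rw [h1]
    calc ∑ j, bD.repr x j • w j = ∑ j, ∑ k, (bD.repr x j • Y k j) ⊗ₜ[ℚ_[p]] b k := by
          refine Finset.sum_congr rfl fun j _ => ?_
          change bD.repr x j • ∑ k, Y k j ⊗ₜ[ℚ_[p]] b k = _
          rw [Finset.smul_sum]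
          refine Finset.sum_congr rfl fun k _ => ?_
          rw [TensorProduct.smul_tmul']
      _ = ∑ k, ∑ j, (bD.repr x j • Y k j) ⊗ₜ[ℚ_[p]] b k := Finset.sum_comm
      _ = ∑ k, (∑ j, bD.repr x j • Y k j) ⊗ₜ[ℚ_[p]] b k := by
          refine Finset.sum_congr rfl fun k _ => ?_
          rw [TensorProduct.sum_tmul]
  by_cases hi : i ≤ 0
  · -- `Fil^i D = D`
    have htop : 𝔅.filD ρ i = ⊤ := by
      rw [eq_top_iff]
      intro x _
      rw [PeriodRingData.mem_filD_iff, hrepr x]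
      refine 𝔅.sum_tmul_mem_filTensor b fun k => Submodule.sum_mem _ fun j _ => Submodule.smul_mem _ _ ?_
      exact 𝔅.fil_antitone hi (hι0 (X k j))
    rw [if_pos hi, htop, finrank_top, hadm]
  · -- `Fil^i D = 0` for `i ≥ 1`
    have hbot : 𝔅.filD ρ i = ⊥ := by
      rw [eq_bot_iff]
      intro x hx
      have hx1 : x ∈ 𝔅.filD ρ 1 := 𝔅.filD_antitone ρ (show (1 : ℤ) ≤ i by omega) hx
      rw [PeriodRingData.mem_filD_iff, hrepr x] at hx1
      have hg : ∀ k, (∑ j, bD.repr x j • Y k j) ∈ 𝔅.fil 1 := fun k =>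
        𝔅.mem_fil_of_sum_tmul_mem_filTensor b hx1 k
      have hc : (fun j => bD.repr x j) = 0 := hι1 hXu hg
      rw [Submodule.mem_bot]
      apply bD.repr.injective
      rw [map_zero]
      ext j
      exact congrFun hc j
    rw [if_neg hi, hbot, finrank_bot]

/-- **Unramified representations have all Hodge–Tate weights `0`** for every period ring `B`
receiving `W(k̄)` in `Fil⁰` with `Fil¹` detecting `θ` (hypotheses as in
`finrank_filD_of_unramified_witt`): `hodgeTateWeights ρ = {0, …, 0}` (`dim ρ` times) — the generic
form of clause (F3) `UnramifiedWeightsZero` (Fontaine: unramified ⇒ crystalline, `Fil⁰ D = D`,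
`Fil¹ D = 0`). [cite: FontaineAsterisque223III, Exp. III §5] [cite: FontaineOuyang2022, Prop. 2.14] -/
theorem PeriodRingData.hodgeTateWeights_of_unramified_witt
    (𝔅 : PeriodRingData.{0, 0, 0, w₁} (absoluteGaloisGroup F) ℚ_[p] F)
    (ι : WittVector p (IsLocalRing.ResidueField (maxUnramifiedCompletion F)) →+* 𝔅.B)
    (hισ : ∀ (σ : absoluteGaloisGroup F) (x : WittVector p (IsLocalRing.ResidueField (maxUnramifiedCompletion F))),
      σ • ι x = ι (wittGal σ x))
    (hιp : ∀ z : ℤ_[p], ι (padicIntToWitt F p z) = algebraMap ℚ_[p] 𝔅.B (z : ℚ_[p]))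
    (hι0 : ∀ x, ι x ∈ 𝔅.fil 0)
    (hι1 : ∀ {N : ℕ} {X : Matrix (Fin N) (Fin N) (WittVector p (IsLocalRing.ResidueField (maxUnramifiedCompletion F)))},
      IsUnit X → ∀ {c : Fin N → F}, (∀ k, (∑ j, c j • ι (X k j)) ∈ 𝔅.fil 1) → c = 0)
    {V : Type w₂} [AddCommGroup V] [Module ℚ_[p] V] [TopologicalSpace V] [IsTopologicalAddGroup V]
    [ContinuousSMul ℚ_[p] V] [T2Space V] [FiniteDimensional ℚ_[p] V]
    (ρ : ContinuousRep (absoluteGaloisGroup F) ℚ_[p] V)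
    (hρ : ∀ σ ∈ absInertia F, ∀ v : V, ρ σ v = v) :
    𝔅.hodgeTateWeights ρ = Multiset.replicate (Module.finrank ℚ_[p] V) 0 := by
  rw [PeriodRingData.hodgeTateWeights_eq_jumpMultiset]
  have h : (fun i => Module.finrank F (𝔅.filD ρ i)) = fun i => if i ≤ 0 then Module.finrank ℚ_[p] V else 0 :=
    funext fun i => PeriodRingData.finrank_filD_of_unramified_witt 𝔅 ι hισ hιp hι0 hι1 ρ hρ i
  rw [h, jumpMultiset_step]

end Literature.NumberTheory.PAdicHodge

end
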